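import Literature.MathematicalPhysics.QuantumFieldTheory.BalabanImbrieJaffe1984to88.BIJ88Form41Succ
import Literature.MathematicalPhysics.QuantumFieldTheory.BalabanImbrieJaffe1984to88.BIJ88Compatibility5154

/-!
# `BalabanImbrieJaffe1984to88.BIJ88InductiveForm41C` — T. Bałaban, J. Imbrie, A. Jaffe, *Effective action and cluster properties of the abelian
Higgs model*, Commun. Math. Phys. **114** (1988) 257–315 [BalabanImbrieJaffe1988], (4.1) p. 273 [PDF 17] read together with (5.15.2)/(5.15.4)
pp. 313–314 [PDF 57–58]: **THE INDUCTIVE FORM (4.1) WITH COMPLEX-VALUED HOLE FUNCTIONALS** — the append-only remedy (a) of HOME/GAPS.md **G-C2-26**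
(p31 gen 14; §5 owner r16: *"CONCUR … preferred remedy = (a), an append-only ℂ-valued twin with r18's (4.1) as its real case"*, ROWS-C2-part2 v2.126).

statement-level skeleton of published theorems with citation tags; proofs where landed; nothing here is a claim about the Yang–Mills mass gap

THE POINT (G-C2-26, verbatim sources in its GAPS entry).  r18's typed (4.1) `BIJ88InductiveForm41.Term41` declares the hole functionals `g_k(X_ω)`
REAL-valued; p. 274 prints only *"The factors g_k(X_ω) represent the effect of large fields or irrelevant interactions from all previous steps. The
factors g_k(X_ω) depend on u^{(j)}, 0 ≦ j ≦ k−1 and on u, φ"*, and (5.15.2)/(5.15.4) put the complex observable factors `Π_{c′: X_{c′} ⊂ X_{ω′}}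
F_{k+1,loc}(X_{c′})` (components not inside `Λ^{(k)}_{13}`) INSIDE `g_{k+1}(X_{ω′})`.  So the printed `ρ_{k+1}` is a (4.1) density with COMPLEX hole
functionals.  This file types that object WITHOUT touching r18's declarations (def-body guard; Q-OWN-1′): a term `Term41C` IS r18's `Term41` (all the
(4.1) data, real hole slot included) TOGETHER WITH a finite family of complex hole functionals; its density `rhoPrimeC T = rhoPrime T.base · Π_ω T.gC ω`
reuses r18's `rhoPrime` verbatim, so every theorem about (4.1) in r18's vocabulary (and this seat's `BIJ88Form41Succ`) transfers BY NAME; r18's (4.1) is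
the case of no complex hole functional (`ofTerm41`, `rhoPrimeC_ofTerm41 : rhoPrimeC (ofTerm41 T) = rhoPrime T`).

WHAT IS PROVED HERE (four small definitions with bodies — `Term41C`, `ofTerm41`, `rhoPrimeC`/`rhoC`/`Represents41C` (display transcriptions in r18's
shape), `scaleTermC` — and theorems; 0 `sorry`; no `Prop`-valued fact besides the representation sentence `Represents41C` (a `def … : Prop` DISPLAY
exactly like r18's `Represents41`, not a cited result); standard axioms).
* §1 `Term41C`, `rhoPrimeC`, `rhoC`, `Represents41C` ((4.1)/p. 274 with complex holes); `ofTerm41` and the bridges **`rhoPrimeC_ofTerm41`**, **`rhoC_ofTerm41`**,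
  **`represents41C_ofTerm41_iff`** (r18's (4.1) = the real case, definitionally up to `Finset.prod` over an empty index).
* §2 the scaling (5.15.3) on the twin: `scaleTermC` (= this seat's `scaleTerm` on the base, the complex holes read at `cφ`), **`rhoPrimeC_scale`**,
  `rhoC_scale`, **`scaleStep_rhoC`** (r16/p34's `scaleStep c` of `rhoC` IS `rhoC` of the scaled terms), **`represents41C_scale_iff`** — `BIJ88Form41Succ`
  §1 transferred BY NAME (`rhoPrime_scale`, `integral_comp_smul_jac`).
* §3 PACKAGING OF THE PRINTED GENERALITY: **`ae_eq_rhoC_of_hole_product`** — p34's hole-product conclusion (`BIJ88HoleProduct5154.ae_eq_hole_product`,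
  literal output type) + a transcription of the GLOBAL factor only (`hG : G_ω = rhoPrime (B ω) ∘ cfg`, `B ω : Term41` — χ, `Π_{σ′}F`, `ΠZ`, the exponential,
  r18's slots; gen 13's §6 and `BIJ88Form41Succ` identify the quadratic forms) ⟹ `ρ =ᵐ (v, ψ) ↦ rhoC holes T′ (cfg v) ψ` for the EXPLICIT
  `T′ ω := ⟨B ω, components, gC⟩` whose complex hole functionals ARE the fibre integrals `∫dφ^{(k)}|_{ext∩X_{ω′}} y_{ω,ω′}` of (5.15.4) (read on the
  unit-lattice gauge field through the left inverse of `cfg`, `holeC_cfg`) — NO realness condition; **`represents41C_of_ae_eq`**, **`represents41C_succ`**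
  (from r18's `Represents41` at level `k`, p34 gen 5's `bracket_eq_integral_of_isRT511` BY NAME, the `∫dvdψ` chain and the `rhoC`-form: `Represents41C` at
  level `k+1`), **`represents41C_succ_scaled`** (after (5.15.3)); **`ae_eq_rhoC_of_compatible`** — the chain BY NAME from the RESULT as a double sum
  (p34's `result41_ae_eq` output) through this seat's `BIJ88Compatibility5154.ae_eq_hole_product_of_compatible` ((α) product parametrization, (β) locality)
  to `rhoC` of the explicit terms whose complex hole functionals are `Σ_d ∫dφ^{(k)}|_{ext∩X_{ω′}} z_{ω,ω′}(d)`-integrals — (5.15.4)'s `g_{k+1}(X_{ω′})`.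
HONEST SCOPE.  As in `BIJ88Form41Succ`: the hole-product form and the global transcription `hG` are inputs (rows of Sects. 5.4–5.15; p34's `hprod` or
this seat's `BIJ88Compatibility5154`); no bound (row C2.Txt@314); nothing of B1–B16; NOT summit progress; NOT continuum; NOT Clay.  Row C2.Eq4.1 keeps r18's
`Term41`/`rho`/`Represents41` as the decl of record for the display as printed; this twin is the general-case widening of record (r18's ruling above).
CITATION HEADER (lean-in-tree rule).  Part of the lit-balaban TYPED SKELETON (HOME `run/shared/lean/pub/lit-balaban/`), PHASE-2 proof seat p31 gen 14
(unit `lit-balaban-p31-g14`; GAPS G-C2-26 remedy (a); r16 ruling 2026-08-22T08:57:54Z *"CONCUR, remedy (a) preferred"*; r18 ruling 2026-08-22T09:31:04Z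
*"(a)(i): FILE IT — design accepted as is; `Term41`/`rho`/`Represents41` stay the decl of record for the display AS PRINTED (real-hole case), `Term41C`/`rhoC`/
`Represents41C` cited as the GENERAL-CASE widening of record for complex observables absorbed into holes"*, HOME/lit-balaban-p31/INBOX.md).  Rows served: **`C2.Eq4.1`** member (owner r18), **`C2.Claim@313`** member (owner r16: the RESULT packaged in the printed generality).
PDF held: `paper:balaban1988-cmp114-bij-abelian-higgs-effective-action` (journal page = PDF page + 256); pp. 273–274, 313–314 as read for G-C2-26.
Imports this seat's `BIJ88Form41Succ` and `BIJ88Compatibility5154` (Literature + Mathlib); sub-namespace `…BIJ88InductiveForm41C`; nothing of r18's is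
re-declared — the twin CONTAINS a `Term41`.
-/

namespace Literature.MathematicalPhysics.QuantumFieldTheory.BalabanImbrieJaffe1984to88.BIJ88InductiveForm41C

open Literature.MathematicalPhysics.QuantumFieldTheory.Balaban1983to89
open BIJ88Sect3Statements (U1 cfg toC bracket)
open BIJ85Sect1Model (HiggsField)
open BIJ88InductiveForm41 (Term41 Prev prevMeasure rhoPrime rho Represents41)
open BIJ88RTIterated (scaleStep integral_integral_scaleStep)
open BIJ88Sect3Rescaling (integral_comp_smul_jac finrank_higgsField toC_injective_U1)
open BIJ88Scaling313Result (scaleStep_congr_ae)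
open BIJ88RT51GeneralStep (IsRT511)
open BIJ88RT51NoChange (bracket_eq_integral_of_isRT511)
open BIJ88Eq5128Split (Interior)
open BIJ88Form41Succ (scaleTerm rhoPrime_scale integral_integral_congr_ae)
open BIJ88FinalForm313 (cfg41)
open BIJ88Compatibility5154 (ae_eq_hole_product_of_compatible)
open scoped BigOperators
open _root_.MeasureTheory Function

noncomputable section

variable {P : Params} {j : ℕ}

/-! ## §1 (4.1) with complex hole functionals; r18's (4.1) as its real case -/

section Twin

/-- **A TERM OF (4.1) WITH COMPLEX-VALUED HOLE FUNCTIONALS** (p. 273 (4.1) read with (5.15.2)/(5.15.4) p. 313–314, HOME/GAPS.md G-C2-26): r18's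
`Term41` datum `base` — *all* the data of the display, including its real hole slot — together with a finite family `gC` of complex hole functionals
`g_k(X_ω)` (*"depend on u^{(j)}, 0 ≦ j ≦ k−1 and on u, φ"*), e.g. those containing observable factors `Π_{c′: X_{c′}⊂X_{ω′}}F_{k+1,loc}(X_{c′})`.
[cite: BalabanImbrieJaffe1988, (4.1) p.273] -/
structure Term41C (P : Params) (k : ℕ) where
  /-- the (4.1) data in r18's typing (`BIJ88InductiveForm41.Term41`) -/
  base : Term41 P k
  /-- index type of the complex hole functionals of the term -/
  ΩC : Type
  [fintypeΩC : Fintype ΩC]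
  /-- the complex hole functionals `g_k(X_ω)`, `ω ∈ ΩC`, as functions of `({u^{(j)}}, u, φ)` -/
  gC : ΩC → Prev P k → (PBond P k → ℂ) → (Balaban1983to89.Site P k → ℂ) → ℂ

attribute [instance] Term41C.fintypeΩC

/-- **r18's (4.1) term as a term with no complex hole functional** (the real case). [cite: BalabanImbrieJaffe1988, (4.1) p.273] -/
def ofTerm41 (T : Term41 P j) : Term41C P j :=
  { base := T, ΩC := PEmpty, gC := fun ω _ _ _ => nomatch ω }

/-- **(4.1), the term density with complex holes**: `ρ′_k = ρ′_k[base] · Π_{ω∈ΩC} g_k(X_ω)` — r18's `rhoPrime` of the base datum (χ · Π real holes · ΠF ·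
Π[ZZ] · exp[…], symbol by symbol) times the product of the complex hole functionals. [cite: BalabanImbrieJaffe1988, (4.1) p.273] -/
def rhoPrimeC (T : Term41C P j) (prev : Prev P j) (u : PBond P j → ℂ) (φ : Balaban1983to89.Site P j → ℂ) : ℂ :=
  rhoPrime T.base prev u φ * ∏ ω, T.gC ω prev u φ

/-- **(4.1), the density with complex holes**: `ρ_k(u, φ) = Σ_{{X_ω}} ∫Π_{j<k}𝒟u^{(j)} ρ′_k` (r18's `rho` shape, `prevMeasure`). [cite: BalabanImbrieJaffe1988, (4.1) p.273] -/
def rhoC {ι : Type*} (terms : Finset ι) (T : ι → Term41C P j) (u : PBond P j → ℂ) (φ : Balaban1983to89.Site P j → ℂ) : ℂ :=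
  ∑ t ∈ terms, ∫ prev, rhoPrimeC (T t) prev u φ ∂(prevMeasure P j)

/-- p. 274: *"If we integrate this density over the u, φ variables, we obtain our original unnormalized expectation [F]"* — the representation
property for the density with complex holes (r18's `Represents41` shape: `∫𝒟u𝒟φ ρ_k(cfg u, φ) = [F]`). [cite: BalabanImbrieJaffe1988, (4.1) p.274] -/
def Represents41C {ι : Type*} (terms : Finset ι) (T : ι → Term41C P j)
    (S : GaugeField P 0 U1 → (Balaban1983to89.Site P 0 → ℂ) → ℝ) (F : GaugeField P 0 U1 → (Balaban1983to89.Site P 0 → ℂ) → ℂ) : Prop :=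
  ∫ U, (∫ φ : Balaban1983to89.Site P j → ℂ, rhoC terms T (cfg U) φ) ∂(fieldMeasure P j U1) = bracket S F

/-- **r18's (4.1) IS THE REAL CASE**: `ρ′[ofTerm41 T] = ρ′[T]`. [cite: BalabanImbrieJaffe1988, (4.1) p.273] -/
theorem rhoPrimeC_ofTerm41 (T : Term41 P j) (prev : Prev P j) (u : PBond P j → ℂ) (φ : Balaban1983to89.Site P j → ℂ) :
    rhoPrimeC (ofTerm41 T) prev u φ = rhoPrime T prev u φ := by
  simp [rhoPrimeC, ofTerm41]

/-- … hence `ρ_k[ofTerm41 ∘ T] = ρ_k[T]` (r18's `rho`). [cite: BalabanImbrieJaffe1988, (4.1) p.273] -/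
theorem rhoC_ofTerm41 {ι : Type*} (terms : Finset ι) (T : ι → Term41 P j) (u : PBond P j → ℂ) (φ : Balaban1983to89.Site P j → ℂ) :
    rhoC terms (fun t => ofTerm41 (T t)) u φ = rho terms T u φ := by
  simp only [rhoC, rho, rhoPrimeC_ofTerm41]

/-- … and `Represents41C (ofTerm41 ∘ T) ↔ Represents41 T` (r18's predicate). [cite: BalabanImbrieJaffe1988, (4.1) p.274] -/
theorem represents41C_ofTerm41_iff {ι : Type*} (terms : Finset ι) (T : ι → Term41 P j)
    (S : GaugeField P 0 U1 → (Balaban1983to89.Site P 0 → ℂ) → ℝ) (F : GaugeField P 0 U1 → (Balaban1983to89.Site P 0 → ℂ) → ℂ) :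
    Represents41C terms (fun t => ofTerm41 (T t)) S F ↔ Represents41 terms T S F := by
  unfold Represents41C Represents41
  simp_rw [rhoC_ofTerm41]

/-- A term with complex holes vanishes off the support of the small-field characteristic function of its base (r18's `rhoPrime_eq_zero_of_chi`).
[cite: BalabanImbrieJaffe1988, (4.1) p.273] -/
theorem rhoPrimeC_eq_zero_of_chi (T : Term41C P j) {prev : Prev P j} {u : PBond P j → ℂ} {φ : Balaban1983to89.Site P j → ℂ}
    (h : T.base.chi prev u φ = 0) : rhoPrimeC T prev u φ = 0 := by
  rw [rhoPrimeC, BIJ88InductiveForm41.rhoPrime_eq_zero_of_chi T.base h, zero_mul]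

end Twin

/-! ## §2 The scaling (5.15.3) on the twin -/

section Scale

/-- **The term with complex holes after the scaling `ψ^L = cψ¹`**: the base scaled by this seat's `scaleTerm` (g/F/χ/𝒫 at `cφ`, `Δ ↦ c²Δ`, `ℰ ↦ ℰ −
2|T₁|log c`) and the complex hole functionals read at `cφ`. [cite: BalabanImbrieJaffe1988, (5.15.3) p.313] -/
def scaleTermC (c : ℝ) (T : Term41C P j) : Term41C P j :=
  { base := scaleTerm c T.base, ΩC := T.ΩC, gC := fun ω prev u φ => T.gC ω prev u (c • φ) }

/-- **`ρ′[scaleTermC c T](…, φ) = c^{2|T₁|}·ρ′[T](…, cφ)`** (this seat's `rhoPrime_scale` BY NAME; `c > 0`). [cite: BalabanImbrieJaffe1988, (5.15.3) p.313] -/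
theorem rhoPrimeC_scale {c : ℝ} (hc : 0 < c) (T : Term41C P j) (prev : Prev P j) (u : PBond P j → ℂ) (φ : HiggsField P j) :
    rhoPrimeC (scaleTermC c T) prev u φ =
      ((c ^ (2 * Fintype.card (Balaban1983to89.Site P j)) : ℝ) : ℂ) * rhoPrimeC T prev u (c • φ) := by
  have h1 : rhoPrime (scaleTermC c T).base prev u φ =
      ((c ^ (2 * Fintype.card (Balaban1983to89.Site P j)) : ℝ) : ℂ) * rhoPrime T.base prev u (c • φ) := rhoPrime_scale hc T.base prev u φ
  have h2 : (∏ ω, (scaleTermC c T).gC ω prev u φ) = ∏ ω, T.gC ω prev u (c • φ) := rfl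
  rw [rhoPrimeC, rhoPrimeC, h1, h2, mul_assoc]

/-- **`ρ_k[scaleTermC c ∘ T](u, φ) = c^{2|T₁|}·ρ_k[T](u, cφ)`**. [cite: BalabanImbrieJaffe1988, (5.15.3) p.313] -/
theorem rhoC_scale {ι : Type*} (terms : Finset ι) (T : ι → Term41C P j) {c : ℝ} (hc : 0 < c) (u : PBond P j → ℂ) (φ : HiggsField P j) :
    rhoC terms (fun t => scaleTermC c (T t)) u φ =
      ((c ^ (2 * Fintype.card (Balaban1983to89.Site P j)) : ℝ) : ℂ) * rhoC terms T u (c • φ) := by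
  simp only [rhoC, rhoPrimeC_scale hc, integral_const_mul, Finset.mul_sum]

/-- **THE SCALING OF A (4.1) DENSITY WITH COMPLEX HOLES IS ONE**: `scaleStep c ((v, ψ) ↦ ρ_k[T](w v, ψ)) = (v, ψ¹) ↦ ρ_k[scaleTermC c ∘ T](w v, ψ¹)`
(`c > 0`). [cite: BalabanImbrieJaffe1988, (5.15.3) p.313] -/
theorem scaleStep_rhoC {ι : Type*} (terms : Finset ι) (T : ι → Term41C P j) {c : ℝ} (hc : 0 < c)
    (w : GaugeField P j U1 → (PBond P j → ℂ)) :
    scaleStep c (fun v ψ => rhoC terms T (w v) ψ) = fun v ψ => rhoC terms (fun t => scaleTermC c (T t)) (w v) ψ := by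
  funext v ψ
  simp only [scaleStep]
  rw [rhoC_scale terms T hc, finrank_higgsField]

/-- **«then the integral of ρ(v, ψ¹) is equal to the integral of ρ^L(v, ψ^L)»** for the twin: `Represents41C (scaleTermC c ∘ T) S F ↔ Represents41C T S F`
(`c > 0`; p34 gen 1's `integral_comp_smul_jac`). [cite: BalabanImbrieJaffe1988, (5.15.3) p.313] -/
theorem represents41C_scale_iff {ι : Type*} (terms : Finset ι) (T : ι → Term41C P j) {c : ℝ} (hc : 0 < c)
    (S : GaugeField P 0 U1 → (Balaban1983to89.Site P 0 → ℂ) → ℝ) (F : GaugeField P 0 U1 → (Balaban1983to89.Site P 0 → ℂ) → ℂ) :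
    Represents41C terms (fun t => scaleTermC c (T t)) S F ↔ Represents41C terms T S F := by
  have h : ∀ U : GaugeField P j U1,
      ∫ φ : HiggsField P j, rhoC terms (fun t => scaleTermC c (T t)) (cfg U) φ = ∫ φ : HiggsField P j, rhoC terms T (cfg U) φ := by
    intro U
    rw [integral_comp_smul_jac (fun φ => rhoC terms T (cfg U) φ) hc]
    refine integral_congr_ae (ae_of_all _ fun φ => ?_)
    simp only [rhoC_scale terms T hc, finrank_higgsField, Complex.real_smul]
  unfold Represents41C
  simp_rw [h]

end Scale

/-! ## §3 Packaging the printed generality: complex hole functionals = the fibre integrals of (5.15.4) -/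

section Packaging

variable {k : ℕ}

/-- kernel: reading a `U(1)` field in `ℂ` is injective (`toC` is). [cite: BalabanImbrieJaffe1988, (3.1) p.265] -/
theorem cfg_injective : Function.Injective (cfg : GaugeField P (k+1) U1 → (PBond P (k+1) → ℂ)) :=
  fun _ _ h => funext fun b => toC_injective_U1 (congrFun h b)

/-- **The complex hole functional of a component as a function of the unit-lattice gauge field** (`Term41C.gC` takes `u : bonds → ℂ`): a function `h`
of the group-valued block field `v` read through the left inverse of `cfg`. [cite: BalabanImbrieJaffe1988, (5.15.4) p.314] -/
def holeC (h : Prev P (k+1) → GaugeField P (k+1) U1 → HiggsField P (k+1) → ℂ)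
    (prev : Prev P (k+1)) (u : PBond P (k+1) → ℂ) (φ : HiggsField P (k+1)) : ℂ :=
  h prev (Function.invFun (cfg : GaugeField P (k+1) U1 → (PBond P (k+1) → ℂ)) u) φ

/-- kernel: `holeC h prev (cfg v) φ = h prev v φ`. [cite: BalabanImbrieJaffe1988, (5.15.4) p.314] -/
theorem holeC_cfg (h : Prev P (k+1) → GaugeField P (k+1) U1 → HiggsField P (k+1) → ℂ) (prev : Prev P (k+1)) (v : GaugeField P (k+1) U1)
    (φ : HiggsField P (k+1)) : holeC h prev (cfg v) φ = h prev v φ := by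
  simp only [holeC, Function.leftInverse_invFun cfg_injective v]

/-- **THE RESULT IN THE PRINTED GENERALITY IS A (4.1) DENSITY WITH COMPLEX HOLES — EXPLICITLY.**  INPUT: p34's hole-product form of the density (the literal
conclusion of `BIJ88HoleProduct5154.ae_eq_hole_product` / this seat's `BIJ88Compatibility5154.ae_eq_hole_product_of_compatible`): `ρ(v, ψ) = Σ_ω
∫_{Π𝒟u^{(j)}} G_ω·Π_{ω′}(∫dφ^{(k)}|_{ext∩X_{ω′}} y_{ω,ω′})` a.e., and the transcription of the GLOBAL factor ONLY into r18's slots, `hG : G_ω(pp; v, ψ) = ρ′[B ω](pp,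
cfg v, ψ)` (`B ω : Term41`: χ_{k+1}, `Π_{σ′}F_{k+1,loc}`, `Π[ZZ(u_{k+1})]`, the two quadratic forms, `𝒫_{k+1,loc}`, `ℰ` — its real hole slot typically trivial).
CONCLUSION: `ρ = (v, ψ) ↦ rhoC holes T′ (cfg v) ψ` a.e. for the EXPLICIT terms `T′ ω = ⟨B ω, components of ω, gC⟩` whose complex hole functionals ARE the
fibre integrals `g_{k+1}(X_{ω′}) = ∫dφ^{(k)}|_{ext∩X_{ω′}} y_{ω,ω′}` of (5.15.4) — no realness condition (contrast `BIJ88Form41Succ.ae_eq_rho_of_hole_product`).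
[cite: BalabanImbrieJaffe1988, (5.15.4) p.314] -/
theorem ae_eq_rhoC_of_hole_product {Ω : Type*} (holes : Finset Ω) (DΩ : Ω → Interior P k)
    (KΩ : Ω → Type) [∀ ω, Fintype (KΩ ω)] [∀ ω, DecidableEq (KΩ ω)]
    (comp : (ω : Ω) → {x : Balaban1983to89.Site P k // x ∉ (DΩ ω).Ix} → KΩ ω)
    (G : Ω → Prev P (k+1) → GaugeField P (k+1) U1 → HiggsField P (k+1) → ℂ)
    (y : (ω : Ω) → (κ : KΩ ω) → Prev P (k+1) → ({x // comp ω x = κ} → ℂ) → GaugeField P (k+1) U1 → HiggsField P (k+1) → ℂ)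
    {ρL : GaugeField P (k+1) U1 → HiggsField P (k+1) → ℂ}
    (hR : uncurry ρL =ᵐ[(fieldMeasure P (k+1) U1).prod volume]
      uncurry (fun v ψ => ∑ ω ∈ holes, ∫ pp, (G ω pp v ψ * ∏ κ, ∫ w : {x // comp ω x = κ} → ℂ, y ω κ pp w v ψ) ∂prevMeasure P (k+1)))
    (B : Ω → Term41 P (k+1))
    (hG : ∀ ω ∈ holes, ∀ (pp : Prev P (k+1)) (v : GaugeField P (k+1) U1) (ψ : HiggsField P (k+1)),
      G ω pp v ψ = rhoPrime (B ω) pp (cfg v) ψ) :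
    uncurry ρL =ᵐ[(fieldMeasure P (k+1) U1).prod volume]
      uncurry (fun v ψ => rhoC holes
        (fun ω => ({ base := B ω, ΩC := KΩ ω,
                     gC := fun κ => holeC fun pp v' ψ' => ∫ w : {x // comp ω x = κ} → ℂ, y ω κ pp w v' ψ' } : Term41C P (k+1)))
        (cfg v) ψ) := by
  refine hR.trans (Filter.EventuallyEq.of_eq ?_)
  funext q
  simp only [uncurry, rhoC, rhoPrimeC]
  refine Finset.sum_congr rfl fun ω hω => integral_congr_ae (ae_of_all _ fun pp => ?_)
  show G ω pp q.1 q.2 * ∏ κ, ∫ w : {x // comp ω x = κ} → ℂ, y ω κ pp w q.1 q.2 =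
    rhoPrime (B ω) pp (cfg q.1) q.2 *
      ∏ κ, holeC (fun pp v' ψ' => ∫ w : {x // comp ω x = κ} → ℂ, y ω κ pp w v' ψ') pp (cfg q.1) q.2
  rw [hG ω hω pp q.1 q.2]
  refine congrArg (rhoPrime (B ω) pp (cfg q.1) q.2 * ·) (Finset.prod_congr rfl fun κ _ => ?_)
  exact (holeC_cfg (fun pp v' ψ' => ∫ w : {x // comp ω x = κ} → ℂ, y ω κ pp w v' ψ') pp q.1 q.2).symm

/-- **`Represents41C` AT LEVEL `k+1` FROM THE PACKAGED DENSITY** (`ρ` a.e. the `rhoC`-form, `∫dvdψ ρ = [F]`). [cite: BalabanImbrieJaffe1988, (4.1) p.274] -/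
theorem represents41C_of_ae_eq {ι : Type*} (terms : Finset ι) (T' : ι → Term41C P (k+1))
    {ρL : GaugeField P (k+1) U1 → HiggsField P (k+1) → ℂ}
    (hρ : uncurry ρL =ᵐ[(fieldMeasure P (k+1) U1).prod volume] uncurry (fun v ψ => rhoC terms T' (cfg v) ψ))
    {S : GaugeField P 0 U1 → (Balaban1983to89.Site P 0 → ℂ) → ℝ} {F : GaugeField P 0 U1 → (Balaban1983to89.Site P 0 → ℂ) → ℂ}
    (hF : ∫ v, ∫ ψ, ρL v ψ ∂volume ∂fieldMeasure P (k+1) U1 = bracket S F) :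
    Represents41C terms T' S F := by
  unfold Represents41C
  rw [← hF]
  exact (integral_integral_congr_ae hρ).symm

/-- **«WE RECOVER THE INDUCTION HYPOTHESIS FOR k+1», PRINTED GENERALITY**: from r18's `Represents41 terms T S F` at level `k`, (5.1.1) for the (4.1) terms
(p34 gen 5's `IsRT511`, `bracket_eq_integral_of_isRT511` BY NAME), the `∫dvdψ` chain of the §5 operations and the `rhoC`-form of `ρ^L_{k+1}` at level `k+1`:
`Represents41C holes T′ S F` at level `k+1`. [cite: BalabanImbrieJaffe1988, (5.15.4) p.314] -/
theorem represents41C_succ {ι Ω : Type*} (hd : 2 ≤ P.d) {a : ℝ} (ha : 0 < a) {terms : Finset ι} {T : ι → Term41 P k}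
    {S : GaugeField P 0 U1 → (Balaban1983to89.Site P 0 → ℂ) → ℝ} {F : GaugeField P 0 U1 → (Balaban1983to89.Site P 0 → ℂ) → ℂ}
    (h41 : Represents41 terms T S F)
    {Qu : GaugeField P k U1 → GaugeField P (k+1) U1} {Qφ : ι → Prev P k → GaugeField P k U1 → HiggsField P k → HiggsField P (k+1)}
    {ρtilde ρL : GaugeField P (k+1) U1 → HiggsField P (k+1) → ℂ}
    (h511 : IsRT511 terms Qu Qφ a (fun t prev U φ => rhoPrime (T t) prev (cfg U) φ) ρtilde)
    (hint : ∀ t ∈ terms, Integrable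
      (fun q : GaugeField P k U1 × (Prev P k × HiggsField P k) => rhoPrime (T t) q.2.1 (cfg q.1) q.2.2)
      ((fieldMeasure P k U1).prod ((prevMeasure P k).prod volume)))
    (hchain : ∫ v, ∫ ψ, ρL v ψ ∂volume ∂fieldMeasure P (k+1) U1 = ∫ v, ∫ ψ, ρtilde v ψ ∂volume ∂fieldMeasure P (k+1) U1)
    (holes : Finset Ω) (T' : Ω → Term41C P (k+1))
    (hρ : uncurry ρL =ᵐ[(fieldMeasure P (k+1) U1).prod volume] uncurry (fun v ψ => rhoC holes T' (cfg v) ψ)) :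
    Represents41C holes T' S F :=
  represents41C_of_ae_eq holes T' hρ (hchain.trans (bracket_eq_integral_of_isRT511 hd ha h41 h511 hint).symm)

/-- **… AND AFTER THE SCALING (5.15.3)**: for every `c > 0`, `𝒮_cρ^L_{k+1}` is a.e. `rhoC` of the scaled terms `scaleTermC c ∘ T′` and these represent `[F]` at
level `k+1` (this seat's `scaleStep_congr_ae`, `scaleStep_rhoC`, `represents41C_scale_iff`). [cite: BalabanImbrieJaffe1988, (5.15.4) p.314] -/
theorem represents41C_succ_scaled {ι Ω : Type*} (hd : 2 ≤ P.d) {a : ℝ} (ha : 0 < a) {terms : Finset ι} {T : ι → Term41 P k}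
    {S : GaugeField P 0 U1 → (Balaban1983to89.Site P 0 → ℂ) → ℝ} {F : GaugeField P 0 U1 → (Balaban1983to89.Site P 0 → ℂ) → ℂ}
    (h41 : Represents41 terms T S F)
    {Qu : GaugeField P k U1 → GaugeField P (k+1) U1} {Qφ : ι → Prev P k → GaugeField P k U1 → HiggsField P k → HiggsField P (k+1)}
    {ρtilde ρL : GaugeField P (k+1) U1 → HiggsField P (k+1) → ℂ}
    (h511 : IsRT511 terms Qu Qφ a (fun t prev U φ => rhoPrime (T t) prev (cfg U) φ) ρtilde)
    (hint : ∀ t ∈ terms, Integrable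
      (fun q : GaugeField P k U1 × (Prev P k × HiggsField P k) => rhoPrime (T t) q.2.1 (cfg q.1) q.2.2)
      ((fieldMeasure P k U1).prod ((prevMeasure P k).prod volume)))
    (hchain : ∫ v, ∫ ψ, ρL v ψ ∂volume ∂fieldMeasure P (k+1) U1 = ∫ v, ∫ ψ, ρtilde v ψ ∂volume ∂fieldMeasure P (k+1) U1)
    (holes : Finset Ω) (T' : Ω → Term41C P (k+1))
    (hρ : uncurry ρL =ᵐ[(fieldMeasure P (k+1) U1).prod volume] uncurry (fun v ψ => rhoC holes T' (cfg v) ψ)) {c : ℝ} (hc : 0 < c) :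
    uncurry (scaleStep c ρL) =ᵐ[(fieldMeasure P (k+1) U1).prod volume]
        uncurry (fun v ψ => rhoC holes (fun ω => scaleTermC c (T' ω)) (cfg v) ψ) ∧
      Represents41C holes (fun ω => scaleTermC c (T' ω)) S F := by
  have h := scaleStep_congr_ae hc.ne' hρ
  rw [scaleStep_rhoC holes T' hc cfg] at h
  exact ⟨h, (represents41C_scale_iff holes T' hc S F).mpr (represents41C_succ hd ha h41 h511 hint hchain holes T' hρ)⟩

/-- **THE CHAIN BY NAME: RESULT (double sum) → «compatible» → (4.1) with complex holes.**  From the RESULT as the double sum over hole families and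
their compatible data (the literal output of p34's `BIJ88Eq596FibreIntegral.result41_ae_eq`), the coincidence `hD` of the interior sets on a hole
family, the product parametrization `π` of the compatible data with local summands `hloc` (this seat's `BIJ88Compatibility5154`), integrability, and the
transcription `hG` of the global factor into r18's slots: `ρ = (v, ψ) ↦ rhoC holes T′ (cfg v) ψ` a.e. for the explicit `T′` whose complex hole functionals are
`g_{k+1}(X_{ω′}) = ∫dφ^{(k)}|_{ext∩X_{ω′}} Σ_{d} z_{ω,ω′}(d)` — (5.15.4) with its sum over *"… compatible with X_{ω′}"* inside each hole functional.
[cite: BalabanImbrieJaffe1988, (5.15.4) p.314] -/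
theorem ae_eq_rhoC_of_compatible {Ω ι' : Type*} [DecidableEq Ω]
    {Y : ι' → BIJ88Eq5128Split.Cfg P k → GaugeField P (k+1) U1 → HiggsField P (k+1) → ℂ}
    (D : ι' → Interior P k) (holes : Finset Ω) (fam : Ω → Finset ι')
    {ρL : GaugeField P (k+1) U1 → HiggsField P (k+1) → ℂ}
    (hR : uncurry ρL =ᵐ[(fieldMeasure P (k+1) U1).prod volume]
      uncurry (fun v ψ => ∑ ω ∈ holes, ∑ c ∈ fam ω,
        ∫ r, Y c (cfg41 (D c) r) v ψ ∂(prevMeasure P (k+1)).prod (volume : Measure (D c).EX)))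
    (DΩ : Ω → Interior P k) (hD : ∀ ω ∈ holes, ∀ c ∈ fam ω, D c = DΩ ω)
    (KΩ : Ω → Type) [∀ ω, Fintype (KΩ ω)] [∀ ω, DecidableEq (KΩ ω)]
    (comp : (ω : Ω) → {x : Balaban1983to89.Site P k // x ∉ (DΩ ω).Ix} → KΩ ω)
    (G : Ω → Prev P (k+1) → GaugeField P (k+1) U1 → HiggsField P (k+1) → ℂ)
    (C : (ω : Ω) → KΩ ω → Type*) [∀ ω κ, Fintype (C ω κ)]
    (π : (ω : Ω) → {c // c ∈ fam ω} ≃ ((κ : KΩ ω) → C ω κ))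
    (z : (ω : Ω) → (κ : KΩ ω) → C ω κ → Prev P (k+1) → ({x // comp ω x = κ} → ℂ) → GaugeField P (k+1) U1 → HiggsField P (k+1) → ℂ)
    (hloc : ∀ ω ∈ holes, ∀ (c : {c // c ∈ fam ω}) (pp : Prev P (k+1)) (e : (DΩ ω).EX) (v : GaugeField P (k+1) U1) (ψ : HiggsField P (k+1)),
      Y c (cfg41 (DΩ ω) (pp, e)) v ψ = G ω pp v ψ * ∏ κ, z ω κ (π ω c κ) pp (fun j => e j.1) v ψ)
    (hYi : ∀ ω ∈ holes, ∀ c ∈ fam ω, ∀ (v : GaugeField P (k+1) U1) (ψ : HiggsField P (k+1)),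
      Integrable (fun r => Y c (cfg41 (DΩ ω) r) v ψ) ((prevMeasure P (k+1)).prod (volume : Measure (DΩ ω).EX)))
    (B : Ω → Term41 P (k+1))
    (hG : ∀ ω ∈ holes, ∀ (pp : Prev P (k+1)) (v : GaugeField P (k+1) U1) (ψ : HiggsField P (k+1)),
      G ω pp v ψ = rhoPrime (B ω) pp (cfg v) ψ) :
    uncurry ρL =ᵐ[(fieldMeasure P (k+1) U1).prod volume]
      uncurry (fun v ψ => rhoC holes
        (fun ω => ({ base := B ω, ΩC := KΩ ω,
                     gC := fun κ => holeC fun pp v' ψ' =>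
                       ∫ w : {x // comp ω x = κ} → ℂ, ∑ d, z ω κ d pp w v' ψ' } : Term41C P (k+1)))
        (cfg v) ψ) :=
  ae_eq_rhoC_of_hole_product holes DΩ KΩ comp G (fun ω κ pp w v ψ => ∑ d, z ω κ d pp w v ψ)
    (ae_eq_hole_product_of_compatible D holes fam hR DΩ hD KΩ comp G C π z hloc hYi) B hG

end Packaging

end

end Literature.MathematicalPhysics.QuantumFieldTheory.BalabanImbrieJaffe1984to88.BIJ88InductiveForm41C
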